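import Literature.Barriers.CriticalPhenomena.TreesPercolatingAtCriticalityWedgeProofs
import Literature.Probability.Percolation.SubgraphMonotonicity
import Literature.Probability.Percolation.KestenTheoremProofs
import HarnessLib

/-!
# Transplant sharpness IV — the gridded log-wedge: a subgraph of `ℤ²` squeezed between the mesh-`M` grid and `ℤ²`

builds on p205010 (kernel theorem, internal audit signed; external expert review pending).
Status sentence (coordinator 2026-08-20T04:30Z): "θ(p_c) = 0 on ℤ^d, all d ≥ 2 — kernel-verified (Lean 4/Mathlib,
standard axioms); internal adversarial audit SIGNED 2026-08-20 04:29Z; external expert review pending."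

Lane `prim-bschramm`, seat p5 (sharpness); memo `run/shared/lean/prim/bschramm/P5-SHARPNESS.md` §40 (row 83) and
`run/shared/lean/prim/bschramm/prim-bschramm-p5-g19/GRIDWEDGE-PROOF.md`.  HOUSE construction (not a published
statement): for Grimmett's logarithmic wedge `W = logWedge a b` (`b > 2a > 0`, Grimmett 1999 Thm. (11.55) and p. 306;
tree `LogWedgePercolatingAtCriticality_holds`: `½ < p_c(W) < 1`, `θ_W(o, p_c(W)) > 0`) and the grid
`L_M = {x : M ∣ x₀ ∨ M ∣ x₁}` of mesh `M`, the GRIDDED WEDGE is the induced subgraph `G′ = ℤ²[W ∪ L_M]`.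
It is planar of degree `≤ 4`, contains the whole mesh-`M` grid (so its vertex set is `⌊M/2⌋`-dense in `ℤ²` and
`ℤ²[L_M] ⊆ G′ ⊆ ℤ²`), and — this file, the EASY HALF, all PROVED —

* `theta_logWedge_le_theta_gridWedge` : `θ_W(o,p) ≤ θ_{G′}(o,p)` (coupling, `theta_induce_mono_holds`);
* `criticalProb_gridWedge_le` / `half_le_criticalProb_gridWedge` : `½ = p_c(ℤ²) ≤ p_c(G′) ≤ p_c(W) < 1`;
* `theta_gridWedge_pos_at_wedge_criticalProb` : `θ_{G′}(o, p_c(W)) > 0`;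
* `theta_gridWedge_eq_zero_of_le_half` : `θ_{G′}(o, p) = 0` for `p ≤ ½` (Harris–Kesten + `G′ ⊆ ℤ²`);
* `gridLines_dense` : every lattice point is within horizontal distance `⌊M/2⌋` of `L_M ⊆ V(G′)`.

The HARD HALF is the house proposition `p_c(G′) = p_c(W)` (for `π^{M-1} ≤ 1/30`, `π = p_c(W)`; paper-level
proof in GRIDWEDGE-PROOF.md §4: below `π` the wedge is cut by closed dual box-crossings in every
dyadic block with probability `→ 1` (Grimmett (11.57)–(11.59); tree `eventually_block_estimate`,
`one_le_boxCount_mul_faceProb`), and each cut is completed to a blocked dual circuit around `o` through the mesh-`M`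
hole lattice, whose walls are passable with probability `1 - p^M ≥ 29/30` (stopping time + fresh edges + Peierls));
it enters this file only as the HYPOTHESIS of the reduction
`gridWedge_percolates_at_own_criticalProb_of_le` (NOT proved here): given it, `G′` percolates at ITS OWN critical point, i.e. a
planar bounded-degree graph rough-isometric to `ℤ²` (multiplicative constant `1`) with `θ(p_c) > 0` — continuity of
`θ` at `p_c` is then not a rough-isometry invariant even inside the rough-isometry class of `ℤ²` (P5-SHARPNESS rows
81–83; Lyons–Peres 2016 §2.6 for rough isometries; Benjamini–Schramm 1996, remark after Conj. 4).

References: G. Grimmett, *Percolation*, 2nd ed. (1999), §11.5, Thm. (11.55), pp. 303–309, Lemma (11.12), Thm. (11.11);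
T. E. Harris, Proc. Cambridge Philos. Soc. 56 (1960); H. Kesten, Comm. Math. Phys. 74 (1980);
R. Lyons, Y. Peres, *Probability on Trees and Networks* (2016), §2.6; I. Benjamini, O. Schramm, ECP 1 (1996), Conj. 4.
-/

noncomputable section

namespace Summit.CriticalPhenomena.PercolationContinuityZ3.Theorems.TransplantSharpness

open MeasureTheory Literature.Probability.Percolation Literature.Probability.LatticeModels
open Literature.Barriers.CriticalPhenomena
open scoped unitInterval

/-! ## The objects -/

/-- The grid lines of mesh `M` in `ℤ²`: `L_M = {x : M ∣ x₀ ∨ M ∣ x₁}` (for `M ≥ 2` the induced subgraph `ℤ²[L_M]` is `ℤ²`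
with every edge subdivided into `M` edges). House notation, P5-SHARPNESS §40. -/
def gridLines (M : ℕ) : Set (Site 2) :=
  {x | (M : ℤ) ∣ x 0 ∨ (M : ℤ) ∣ x 1}

/-- The vertex set of the gridded wedge: Grimmett's logarithmic wedge `logWedge a b` together with the grid lines of
mesh `M`. House notation, P5-SHARPNESS §40. -/
def gridWedge (a b : ℝ) (M : ℕ) : Set (Site 2) :=
  logWedge a b ∪ gridLines M

/-- The GRIDDED WEDGE `G′ = ℤ²[W ∪ L_M]`: the subgraph of the square lattice induced on `gridWedge a b M`
(bond percolation "on `G′`" as in Grimmett 1999 §11.5 p. 303 for subsets of `ℤ²`). House construction,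
P5-SHARPNESS §40 row 83. -/
abbrev gridWedgeGraph (a b : ℝ) (M : ℕ) : SimpleGraph (gridWedge a b M) :=
  (zdGraph 2).induce (gridWedge a b M)

/-- The wedge is part of the gridded wedge. [folklore] -/
theorem logWedge_subset_gridWedge (a b : ℝ) (M : ℕ) : logWedge a b ⊆ gridWedge a b M :=
  Set.subset_union_left

/-- The grid is part of the gridded wedge. [folklore] -/
theorem gridLines_subset_gridWedge (a b : ℝ) (M : ℕ) : gridLines M ⊆ gridWedge a b M :=
  Set.subset_union_right

/-- The origin lies on the grid lines (`M ∣ 0`). [folklore] -/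
theorem zero_mem_gridLines (M : ℕ) : (0 : Site 2) ∈ gridLines M := by
  simp [gridLines]

/-- The origin (the apex of the wedge) lies in the gridded wedge. [folklore] -/
theorem zero_mem_gridWedge (a b : ℝ) (M : ℕ) : (0 : Site 2) ∈ gridWedge a b M :=
  logWedge_subset_gridWedge a b M (zero_mem_logWedge a b)

/-- The apex `o = (0,0)` as a vertex of the gridded wedge. [folklore] -/
def gridWedgeOrigin (a b : ℝ) (M : ℕ) : gridWedge a b M :=
  ⟨0, zero_mem_gridWedge a b M⟩

/-- The apex of the gridded wedge is the image of the apex of the wedge under the inclusion `W ⊆ W ∪ L_M`. [folklore] -/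
theorem gridWedgeOrigin_eq (a b : ℝ) (M : ℕ) :
    gridWedgeOrigin a b M = ⟨(logWedgeOrigin a b : Site 2), logWedge_subset_gridWedge a b M (logWedgeOrigin a b).2⟩ :=
  rfl

/-! ## Density of the grid: `V(G′)` is `⌊M/2⌋`-dense in `ℤ²` -/

/-- Every lattice point lies within horizontal distance `⌊M/2⌋ ≤ M/2` of a vertical grid line, hence of `L_M ⊆ V(G′)`:
for `x ∈ ℤ²` and `M ≥ 1` there is `y ∈ gridLines M` in the same row with `|x₀ - y₀| ≤ M/2`. (The coboundedness half of
"the inclusion `V(G′) ↪ ℤ²` is a rough isometry"; the distortion half `d_{ℤ²} ≤ d_{G′} ≤ d_{ℤ²} + 3M` is GRIDWEDGE-PROOF.md §2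
and is not typed here.) [folklore] -/
theorem gridLines_dense {M : ℕ} (hM : 1 ≤ M) (x : Site 2) :
    ∃ y ∈ gridLines M, y 1 = x 1 ∧ 2 * |x 0 - y 0| ≤ (M : ℤ) := by
  have hMpos : (0 : ℤ) < (M : ℤ) := by exact_mod_cast hM
  obtain ⟨q, r, hdecomp, hr0, hrM⟩ : ∃ q r : ℤ, x 0 = (M : ℤ) * q + r ∧ 0 ≤ r ∧ r < M :=
    ⟨x 0 / M, x 0 % M, (Int.mul_ediv_add_emod _ _).symm, Int.emod_nonneg _ hMpos.ne', Int.emod_lt_of_pos _ hMpos⟩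
  by_cases h2 : 2 * r ≤ (M : ℤ)
  · refine ⟨![(M : ℤ) * q, x 1], Or.inl ⟨q, by simp⟩, by simp, ?_⟩
    have h : x 0 - (M : ℤ) * q = r := by omega
    simp only [Matrix.cons_val_zero]
    rw [h, abs_of_nonneg hr0]
    exact h2
  · refine ⟨![(M : ℤ) * (q + 1), x 1], Or.inl ⟨q + 1, by simp⟩, by simp, ?_⟩
    have h : x 0 - (M : ℤ) * (q + 1) = r - M := by rw [hdecomp]; ring
    simp only [Matrix.cons_val_zero]
    rw [h, abs_of_nonpos (by omega)]
    omega

/-! ## The easy half: `W ⊆ G′ ⊆ ℤ²` -/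

/-- **Coupling, lower side**: the gridded wedge percolates at least as well as the wedge, `θ_W(o, p) ≤ θ_{G′}(o, p)` for
every `p` (`W ⊆ W ∪ L_M`, `theta_induce_mono_holds`). [folklore] -/
theorem theta_logWedge_le_theta_gridWedge (a b : ℝ) (M : ℕ) (p : unitInterval) :
    theta (logWedgeGraph a b) (logWedgeOrigin a b) p ≤ theta (gridWedgeGraph a b M) (gridWedgeOrigin a b M) p :=
  theta_induce_mono_holds (zdGraph 2) (logWedge_subset_gridWedge a b M) 0 (zero_mem_logWedge a b) p

/-- **Coupling, upper side**: `θ_{G′}(o, p) ≤ θ_{ℤ²}(0, p)` for every `p` (`G′ ⊆ ℤ²`, `theta_induce_le_holds`). [folklore] -/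
theorem theta_gridWedge_le_theta_zd (a b : ℝ) (M : ℕ) (p : unitInterval) :
    theta (gridWedgeGraph a b M) (gridWedgeOrigin a b M) p ≤ theta (zdGraph 2) (0 : Site 2) p :=
  theta_induce_le_holds (zdGraph 2) (gridWedge a b M) 0 (zero_mem_gridWedge a b M) p

/-- `p_c(G′) ≤ p_c(W)`: enlarging the vertex set lowers the critical point (`criticalProb_induce_anti`). [folklore] -/
theorem criticalProb_gridWedge_le (a b : ℝ) (M : ℕ) :
    criticalProb (gridWedgeGraph a b M) (gridWedgeOrigin a b M) ≤
      criticalProb (logWedgeGraph a b) (logWedgeOrigin a b) :=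
  criticalProb_induce_anti theta_induce_mono_holds (zdGraph 2) (logWedge_subset_gridWedge a b M) 0
    (zero_mem_logWedge a b)

/-- `p_c(ℤ²) ≤ p_c(G′)` (`criticalProb_le_induce`), i.e. `½ ≤ p_c(G′)` by Kesten's theorem `p_c(ℤ²) = ½`
(`kesten_criticalProb_Z2_holds`). [folklore] -/
theorem half_le_criticalProb_gridWedge (a b : ℝ) (M : ℕ) :
    (1 / 2 : ℝ) ≤ criticalProb (gridWedgeGraph a b M) (gridWedgeOrigin a b M) := by
  have h := criticalProb_le_induce theta_induce_le_holds (zdGraph 2) (gridWedge a b M) 0 (zero_mem_gridWedge a b M)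
  have hK : criticalProb (zdGraph 2) 0 = 1 / 2 := kesten_criticalProb_Z2_holds
  rw [hK] at h
  exact h

/-- Below and at `½` the gridded wedge does not percolate: `θ_{G′}(o, p) = 0` for `p ≤ ½` (Harris 1960 / Kesten 1980,
`Kesten1980_theta_eq_zero`, and `G′ ⊆ ℤ²`). [folklore] -/
theorem theta_gridWedge_eq_zero_of_le_half (a b : ℝ) (M : ℕ) (p : unitInterval) (hp : (p : ℝ) ≤ 1 / 2) :
    theta (gridWedgeGraph a b M) (gridWedgeOrigin a b M) p = 0 :=
  le_antisymm ((theta_gridWedge_le_theta_zd a b M p).trans_eq (Kesten1980_theta_eq_zero p hp)) measureReal_nonneg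

/-- **The gridded wedge percolates at the wedge's critical point**: for `b > 2a > 0` and every `M`,
`½ < p_c(W) < 1`, `½ ≤ p_c(G′) ≤ p_c(W)` and `θ_{G′}(o, p_c(W)) > 0` — from Grimmett's Thm. (11.55) + p. 306 in the tree
(`LogWedgePercolatingAtCriticality_holds`) and the coupling `W ⊆ G′`. So at the density `p_c(W)` the planar,
degree-`≤ 4`, grid-containing graph `G′` percolates; whether `p_c(W)` IS the critical point of `G′` is the house
proposition of P5-SHARPNESS §40.2 (hypothesis `h` of `gridWedge_percolates_at_own_criticalProb_of_le` below). [folklore] -/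
theorem theta_gridWedge_pos_at_wedge_criticalProb {a b : ℝ} (ha : 0 < a) (hab : 2 * a < b) (M : ℕ) :
    1 / 2 < criticalProb (logWedgeGraph a b) (logWedgeOrigin a b) ∧
      criticalProb (logWedgeGraph a b) (logWedgeOrigin a b) < 1 ∧
        (1 / 2 : ℝ) ≤ criticalProb (gridWedgeGraph a b M) (gridWedgeOrigin a b M) ∧
          criticalProb (gridWedgeGraph a b M) (gridWedgeOrigin a b M) ≤
            criticalProb (logWedgeGraph a b) (logWedgeOrigin a b) ∧
          0 < theta (gridWedgeGraph a b M) (gridWedgeOrigin a b M)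
            ⟨criticalProb (logWedgeGraph a b) (logWedgeOrigin a b), criticalProb_mem_Icc _ _⟩ := by
  obtain ⟨h1, h2, h3⟩ := LogWedgePercolatingAtCriticality_holds a b ha hab
  exact ⟨h1, h2, half_le_criticalProb_gridWedge a b M, criticalProb_gridWedge_le a b M,
    h3.trans_le (theta_logWedge_le_theta_gridWedge a b M _)⟩

/-! ## The hard half as a hypothesis: `p_c(W) ≤ p_c(G′)` -/

/-- **Reduction (PROVED) of the house proposition "the gridded wedge percolates at ITS OWN critical point"
(P5-SHARPNESS §40.2 row 83; GRIDWEDGE-PROOF.md) to the one-sided bound `p_c(W) ≤ p_c(G′)`.**  Since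
`p_c(G′) ≤ p_c(W)` is `criticalProb_gridWedge_le`, the hypothesis `h` gives `p_c(G′) = p_c(W)`, and then
`theta_gridWedge_pos_at_wedge_criticalProb` yields `½ < p_c(G′) < 1` and `θ_{G′}(o, p_c(G′)) > 0` for the planar,
degree-`≤ 4`, grid-containing subgraph `G′ = ℤ²[W ∪ L_M]` of `ℤ²` — i.e. (given `h`) continuity of `θ` at `p_c` fails
inside the rough-isometry class of `ℤ²`.  The hypothesis `h` ("`θ_{G′}(o, p) = 0` for every `p < p_c(W)`") is NOT in the
tree; its paper-level proof for `p_c(W)^{M-1} ≤ 1/30` (GRIDWEDGE-PROOF.md §4): at `p < p_c(W)` one has `a < ξ(1-p)`, so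
in every dyadic block of columns `[2^k, 2^{k+1}]` some dual square of side `≈ a(k+1) log 2` standing on the axis is
crossed top to bottom by a closed dual path with probability `→ 1` (Grimmett 1999 (11.57)–(11.59); tree
`eventually_block_estimate`, `one_le_boxCount_mul_faceProb`); exploring these squares left to right and stopping at
the first crossed one, the crossing is completed — through holes of the mesh-`M` grid (where `G′` has no edges) and
walls that are passable with probability `1 - p^M`, using only unexplored edges — to a dual circuit around `o` all of
whose edges cross closed or absent edges of `G′`, with conditional probability `≥ 0.9 (1 - p)` (Peierls counting at
wall-density `≤ 1/30`, eleven rectangle crossings); the circuits of the blocks `k ≡ 0 (mod 4)` use disjoint edge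
sets, so almost surely one occurs and the `G′`-cluster of `o` is finite. [folklore] -/
theorem gridWedge_percolates_at_own_criticalProb_of_le {a b : ℝ} (ha : 0 < a) (hab : 2 * a < b) (M : ℕ)
    (h : criticalProb (logWedgeGraph a b) (logWedgeOrigin a b) ≤
      criticalProb (gridWedgeGraph a b M) (gridWedgeOrigin a b M)) :
    criticalProb (gridWedgeGraph a b M) (gridWedgeOrigin a b M) =
        criticalProb (logWedgeGraph a b) (logWedgeOrigin a b) ∧
      1 / 2 < criticalProb (gridWedgeGraph a b M) (gridWedgeOrigin a b M) ∧
        criticalProb (gridWedgeGraph a b M) (gridWedgeOrigin a b M) < 1 ∧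
          0 < theta (gridWedgeGraph a b M) (gridWedgeOrigin a b M)
            ⟨criticalProb (gridWedgeGraph a b M) (gridWedgeOrigin a b M), criticalProb_mem_Icc _ _⟩ := by
  have heq : criticalProb (gridWedgeGraph a b M) (gridWedgeOrigin a b M) =
      criticalProb (logWedgeGraph a b) (logWedgeOrigin a b) :=
    le_antisymm (criticalProb_gridWedge_le a b M) h
  obtain ⟨h1, h2, -, -, h5⟩ := theta_gridWedge_pos_at_wedge_criticalProb ha hab M
  refine ⟨heq, by rw [heq]; exact h1, by rw [heq]; exact h2, ?_⟩
  have hp : (⟨criticalProb (gridWedgeGraph a b M) (gridWedgeOrigin a b M), criticalProb_mem_Icc _ _⟩ : unitInterval) =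
      ⟨criticalProb (logWedgeGraph a b) (logWedgeOrigin a b), criticalProb_mem_Icc _ _⟩ := Subtype.ext heq
  rw [hp]
  exact h5

end Summit.CriticalPhenomena.PercolationContinuityZ3.Theorems.TransplantSharpness

end
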